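import Summits.AnomalousDissipation.AnomalousDissipation.Theorems.BaireTransferRobustLoudUpgradeLineLeaf

/-!
# Line `malkin-cone-group-orbits`, companion c2 ("Lyapunov–Schmidt crossing"): vocabulary and glue for the crux
# `BaireTransfer.RobustLoudUpgrade` (stmt-AnomalousDissipation-1144)

DEFINITIONS file of the companion (reviewed); the glue theorems composing the landed stubs are in
`…LineCrossingGlue.lean`.  Here: the vocabulary, two definitional inclusions, and the parametric composition engine.

SCOPE of the companion.  Among loud steady witnesses with a ONE-dimensional kernel of the linearisation `L(ν,u₀)`, the
generation-1 skeleton v5 reaches the force-VISIBLE degeneracies (`simpleSteady`); this file organises the INVISIBLE ones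
through the genuine Lyapunov–Schmidt family of the witness — the steady lattice map bordered by an ARBITRARY admissible
smooth field `h ∉ range L(ν,u₀)` with the kernel coordinate freed (`LsFamily.stub_lsFamily`, landed): a real function
`σ(c', x)` near `(c, 0)` whose zeros are exactly the mean-zero steady states of `f_{c'}` near `u₀`.

* `crossingSteady` — `σ(c, ·)` takes both signs at `0` (odd index: cusps, pitchfork centres, …): by the intermediate
  value theorem the witness PERSISTS (`CrossingPersist.stub_crossingPersist`), so `⊆ persistSteady ⊆ interior LOUD`.
* `robustCrossingSteady` — sign changes of `σ(c₁, ·)` only at forces `c₁ → c`: `⊆ closure (interior LOUD)`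
  (`RobustCrossingClosure.stub_robustCrossingClosure`).
* `subharmonicSteady` — the first concrete member: a SUBHARMONIC (half-period-translation ℤ₂) pitchfork centre — force and
  witness invariant under a lattice translation `b`, simple `b`-antiperiodic kernel, a `b`-antiperiodic cokernel
  representative `h`, isolation; equivariance + uniqueness make `σ(c, ·)` odd (`SubharmonicSign.stub_subharmonicSign`),
  isolation makes it non-zero off `0`, hence `⊆ crossingSteady` — persistence with NO visibility inside `P_S`.
* `foldSteady` — the second concrete member: a TRANSVERSAL FOLD in the force family — simple kernel `v` with non-zero
  fold coefficient (`(v·∇)v ∉ range L(ν,u₀)`) and ONE first-order-visible force direction `d ∈ P_S`; the saddle-node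
  sign analysis (`LsFold.stub_lsFold`, abstract input `robustCrossing_of_fold`) makes it a robust crossing, hence
  `⊆ robustCrossingSteady` — NO isolation and NO symmetry hypothesis ("a fold is a limit of the two-solution side").
* `ghostSteady` — the complement inside the scope: `σ` ONE-SIGNED on a neighbourhood of `(c, 0)` (the all-directions
  isola centre of the Disproof's VERDICT (K-window)); recorded here only as vocabulary for the residual.
* `tameCrossing` — v4's `tameLeaf` ∪ the four classes; `tameCrossing_subset_closure_interior_loud`; the parametric
  composition `RobustLoudUpgrade_of_residual` / `line_glue_c2` (registered): any tame union upgrading to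
  `closure (interior LOUD)` plus a residual over the unit stock proves the crux BY NAME.

References: Chow–Hale 1982 Ch. 6; Vanderbauwhede 1982 Ch. 8; Kielhöfer 2012 §I.2, §I.5; the route file (item 1144);
`Cruxes/RobustLoudUpgrade/Lines/malkin_cone_group_orbits_c2.lean` (the checked skeleton of this companion).
-/

-- `Summit.<Summit>.<Problem>` is the tree's mandated summit-side namespace (CONVENTIONS §2); for this
-- single-conjunct summit the two coincide, so the duplicate is deliberate.
set_option linter.dupNamespace false

noncomputable section

open scoped BigOperators Topology
open Filter Set Function TopologicalSpace MeasureTheory UnitAddTorus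

namespace Summit.AnomalousDissipation.AnomalousDissipation.Theorems.RobustLoudUpgrade

open Literature.Analysis.FunctionSpaces Literature.Analysis.FunctionSpaces.Torus
open Literature.Analysis.FunctionSpaces.EuclideanSpace
open Literature.Analysis.FluidPDE
open Summit.AnomalousDissipation.AnomalousDissipation.Theses.BaireTransfer

/-! ## §1 Vocabulary: crossing, robust crossing, subharmonic pitchfork, ghost -/

/-- **Crossing steady witnesses** (interface of engine (E1)).  `c` carries, at some `ν ∈ (0,a)`, a mean-zero classical
steady state `u₀` with STRICT budgets and a real function `σ` on `P_S × ℝ` such that (i) for every `δ > 0`, on some ball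
around `(c, 0)`, `σ` is continuous and each of its ZEROS `q = (c', x)` yields a mean-zero classical steady state of the
UNCORRECTED force `f_{c'}` within squared `H¹`-distance `δ` of `u₀` (what the Lyapunov–Schmidt family delivers), and
(ii) `x ↦ σ(c, x)` takes BOTH signs in every neighbourhood of `0` (odd index).  (Chow–Hale 1982 Ch. 6.) [folklore] -/
def crossingSteady (S : Finset (Fin 3 → ℤ)) (a E ε : ℝ) : Set (Coeff S) :=
  {c | ∃ ν : ℝ, 0 < ν ∧ ν < a ∧ ∃ (u₀ : UnitAddTorus (Fin 3) → EuclideanSpace ℝ (Fin 3)) (p₀ : UnitAddTorus (Fin 3) → ℝ),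
    Torus.IsSteadyNSState ν (force S c) u₀ p₀ ∧ HasZeroMean u₀ ∧ meanEnergy (fun _ : ℝ => u₀) < E ∧
      ε < meanDissipation ν (fun _ : ℝ => u₀) ∧
      ∃ σ : Coeff S × ℝ → ℝ,
        (∀ δ : ℝ, 0 < δ → ∃ r : ℝ, 0 < r ∧ ContinuousOn σ (Metric.ball (c, (0 : ℝ)) r) ∧
          ∀ q ∈ Metric.ball (c, (0 : ℝ)) r, σ q = 0 →
            ∃ (u' : UnitAddTorus (Fin 3) → EuclideanSpace ℝ (Fin 3)) (p' : UnitAddTorus (Fin 3) → ℝ),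
              Torus.IsSteadyNSState ν (force S q.1) u' p' ∧ HasZeroMean u' ∧ h1DistSq u' u₀ < δ) ∧
        ∀ η : ℝ, 0 < η → ∃ x₁ x₂ : ℝ, |x₁| < η ∧ |x₂| < η ∧ σ (c, x₁) < 0 ∧ 0 < σ (c, x₂)}

/-- **Robustly crossing steady witnesses** (interface of engine (E2)): as `crossingSteady`, except that the sign
change of `σ(c₁, ·)` near `0` is only asked at forces `c₁` ARBITRARILY CLOSE to `c` (not at `c` itself).
(Kielhöfer 2012 §I.5: folds are limits of the two-solution side.) [folklore] -/
def robustCrossingSteady (S : Finset (Fin 3 → ℤ)) (a E ε : ℝ) : Set (Coeff S) :=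
  {c | ∃ ν : ℝ, 0 < ν ∧ ν < a ∧ ∃ (u₀ : UnitAddTorus (Fin 3) → EuclideanSpace ℝ (Fin 3)) (p₀ : UnitAddTorus (Fin 3) → ℝ),
    Torus.IsSteadyNSState ν (force S c) u₀ p₀ ∧ HasZeroMean u₀ ∧ meanEnergy (fun _ : ℝ => u₀) < E ∧
      ε < meanDissipation ν (fun _ : ℝ => u₀) ∧
      ∃ σ : Coeff S × ℝ → ℝ,
        (∀ δ : ℝ, 0 < δ → ∃ r : ℝ, 0 < r ∧ ContinuousOn σ (Metric.ball (c, (0 : ℝ)) r) ∧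
          ∀ q ∈ Metric.ball (c, (0 : ℝ)) r, σ q = 0 →
            ∃ (u' : UnitAddTorus (Fin 3) → EuclideanSpace ℝ (Fin 3)) (p' : UnitAddTorus (Fin 3) → ℝ),
              Torus.IsSteadyNSState ν (force S q.1) u' p' ∧ HasZeroMean u' ∧ h1DistSq u' u₀ < δ) ∧
        ∀ η : ℝ, 0 < η → ∃ (c₁ : Coeff S) (x₁ x₂ : ℝ), dist c₁ c < η ∧ |x₁| < η ∧ |x₂| < η ∧
          σ (c₁, x₁) < 0 ∧ 0 < σ (c₁, x₂)}

/-- **Subharmonic pitchfork centres** (first concrete member of `crossingSteady`).  For some `b ∈ T³`, `f_c` is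
`b`-periodic; `c` carries, at some `ν ∈ (0,a)`, a `b`-periodic mean-zero classical steady state `u₀` with strict
budgets, ISOLATED in `H¹` among the mean-zero steady states of `f_c` at `ν`, whose classical mean-zero kernel lies on the
complex line of one smooth divergence-free mean-zero `b`-ANTIperiodic real field `v` (the subharmonic symmetry-breaking
mode), together with one smooth divergence-free mean-zero `b`-antiperiodic real field `h ∉ range L(ν,u₀)` (a cokernel
representative — e.g. `h = v` when `0` is algebraically simple; NOT required to lie in `P_S`: no visibility inside the
force family is asked).  (Vanderbauwhede 1982 Ch. 8.) [folklore] -/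
def subharmonicSteady (S : Finset (Fin 3 → ℤ)) (a E ε : ℝ) : Set (Coeff S) :=
  {c | ∃ b : UnitAddTorus (Fin 3), (∀ y, force S c (y + b) = force S c y) ∧ ∃ ν : ℝ, 0 < ν ∧ ν < a ∧
    ∃ (u₀ : UnitAddTorus (Fin 3) → EuclideanSpace ℝ (Fin 3)) (p₀ : UnitAddTorus (Fin 3) → ℝ),
    Torus.IsSteadyNSState ν (force S c) u₀ p₀ ∧ HasZeroMean u₀ ∧ meanEnergy (fun _ : ℝ => u₀) < E ∧
      ε < meanDissipation ν (fun _ : ℝ => u₀) ∧ (∀ y, u₀ (y + b) = u₀ y) ∧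
      (∃ ρ : ℝ, 0 < ρ ∧ ∀ (u' : UnitAddTorus (Fin 3) → EuclideanSpace ℝ (Fin 3)) (p' : UnitAddTorus (Fin 3) → ℝ),
        Torus.IsSteadyNSState ν (force S c) u' p' → HasZeroMean u' → h1DistSq u' u₀ < ρ → u' = u₀) ∧
      ∃ (v h : UnitAddTorus (Fin 3) → EuclideanSpace ℝ (Fin 3)), IsSmooth v ∧ IsDivFree v ∧ HasZeroMean v ∧
        (∀ y, v (y + b) = -v y) ∧
        (∀ w, Torus.LinNSResolventRel ν u₀ 0 w 0 → ∃ z : ℂ, w = z • cplx v) ∧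
        IsSmooth h ∧ IsDivFree h ∧ HasZeroMean h ∧ (∀ y, h (y + b) = -h y) ∧
        ∀ w, ¬ Torus.LinNSResolventRel ν u₀ 0 w (cplx h)}

/-- **Transversal folds in the force family** (second concrete member, of `robustCrossingSteady`).  `c` carries, at
some `ν ∈ (0,a)`, a mean-zero classical steady state `u₀` with strict budgets whose classical mean-zero kernel lies on the
complex line of one smooth divergence-free mean-zero real field `v` with NON-ZERO FOLD COEFFICIENT — the self-interaction
`(v·∇)v` is not in the range of `L(ν,u₀)` — and ONE force direction `d ∈ P_S` is first-order visible
(`f_d ∉ range L(ν,u₀)`).  No isolation, no symmetry.  (Kielhöfer 2012 §I.4–I.5: the saddle-node.) [folklore] -/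
def foldSteady (S : Finset (Fin 3 → ℤ)) (a E ε : ℝ) : Set (Coeff S) :=
  {c | ∃ ν : ℝ, 0 < ν ∧ ν < a ∧ ∃ (u₀ : UnitAddTorus (Fin 3) → EuclideanSpace ℝ (Fin 3)) (p₀ : UnitAddTorus (Fin 3) → ℝ),
    Torus.IsSteadyNSState ν (force S c) u₀ p₀ ∧ HasZeroMean u₀ ∧ meanEnergy (fun _ : ℝ => u₀) < E ∧
      ε < meanDissipation ν (fun _ : ℝ => u₀) ∧
      ∃ (v : UnitAddTorus (Fin 3) → EuclideanSpace ℝ (Fin 3)) (d : Coeff S), IsSmooth v ∧ IsDivFree v ∧ HasZeroMean v ∧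
        (∀ w, Torus.LinNSResolventRel ν u₀ 0 w 0 → ∃ z : ℂ, w = z • cplx v) ∧
        (∀ w, ¬ Torus.LinNSResolventRel ν u₀ 0 w (cplx (Torus.convect v v))) ∧
        ∀ w, ¬ Torus.LinNSResolventRel ν u₀ 0 w (cplx (force S d))}

/-- **Loud ghosts** (vocabulary for the residual; NOT a tame class).  A mean-zero classical steady witness `u₀` with strict
budgets together with a real function `σ` whose zeros near `(c, 0)` are exactly signalled as in `crossingSteady`, but
which is ONE-SIGNED on a whole neighbourhood of `(c, 0)`: no force near `c` acquires a transversal zero of `σ` from `u₀`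
— the all-directions isola centre (Disproof.lean, VERDICT (K-window)).  For an isolated simply degenerate witness this is
the only alternative to `crossingSteady ∪ robustCrossingSteady`. [folklore] -/
def ghostSteady (S : Finset (Fin 3 → ℤ)) (a E ε : ℝ) : Set (Coeff S) :=
  {c | ∃ ν : ℝ, 0 < ν ∧ ν < a ∧ ∃ (u₀ : UnitAddTorus (Fin 3) → EuclideanSpace ℝ (Fin 3)) (p₀ : UnitAddTorus (Fin 3) → ℝ),
    Torus.IsSteadyNSState ν (force S c) u₀ p₀ ∧ HasZeroMean u₀ ∧ meanEnergy (fun _ : ℝ => u₀) < E ∧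
      ε < meanDissipation ν (fun _ : ℝ => u₀) ∧
      ∃ σ : Coeff S × ℝ → ℝ,
        (∀ δ : ℝ, 0 < δ → ∃ r : ℝ, 0 < r ∧ ContinuousOn σ (Metric.ball (c, (0 : ℝ)) r) ∧
          ∀ q ∈ Metric.ball (c, (0 : ℝ)) r, σ q = 0 →
            ∃ (u' : UnitAddTorus (Fin 3) → EuclideanSpace ℝ (Fin 3)) (p' : UnitAddTorus (Fin 3) → ℝ),
              Torus.IsSteadyNSState ν (force S q.1) u' p' ∧ HasZeroMean u' ∧ h1DistSq u' u₀ < δ) ∧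
        ∃ η : ℝ, 0 < η ∧ ((∀ q ∈ Metric.ball (c, (0 : ℝ)) η, 0 ≤ σ q) ∨ (∀ q ∈ Metric.ball (c, (0 : ℝ)) η, σ q ≤ 0))}

/-- The tame union of the companion c2: v4's `tameLeaf` plus the crossing, robust-crossing, subharmonic and fold classes.
[folklore] -/
def tameCrossing (S : Finset (Fin 3 → ℤ)) (a E ε : ℝ) : Set (Coeff S) :=
  tameLeaf S a E ε ∪ crossingSteady S a E ε ∪ robustCrossingSteady S a E ε ∪ subharmonicSteady S a E ε ∪
    foldSteady S a E ε

/-! ## §2 Definitional inclusions and the parametric composition engine -/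

namespace LsCrossing

/-- **A crossing at `c` is in particular a robust crossing** (take `c₁ = c`). [folklore] -/
theorem crossingSteady_subset_robustCrossingSteady (S : Finset (Fin 3 → ℤ)) (a E ε : ℝ) :
    crossingSteady S a E ε ⊆ robustCrossingSteady S a E ε := by
  intro c hc
  obtain ⟨ν, hν, hνa, u₀, p₀, hst, h0, hE, hε, σ, hfam, hsign⟩ := hc
  refine ⟨ν, hν, hνa, u₀, p₀, hst, h0, hE, hε, σ, hfam, fun η hη => ?_⟩
  obtain ⟨x₁, x₂, h₁, h₂, hs₁, hs₂⟩ := hsign η hη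
  exact ⟨c, x₁, x₂, by rw [dist_self]; exact hη, h₁, h₂, hs₁, hs₂⟩

/-- A point `(c, x)` with `|x| < r` lies in the ball of radius `r` around `(c, 0)` (sup metric). [folklore] -/
theorem mk_mem_ball {S : Finset (Fin 3 → ℤ)} (c : Coeff S) {x r : ℝ} (hx : |x| < r) :
    (c, x) ∈ Metric.ball (c, (0 : ℝ)) r := by
  rw [Metric.mem_ball, Prod.dist_eq, dist_self, Real.dist_eq, sub_zero]
  exact max_lt (lt_of_le_of_lt (abs_nonneg x) hx) hx

/-- **Composition engine, parametric in the tame union** (pure topology; twin of the laminar companion's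
`RobustLoudUpgrade_of_turbulentResidual`): any family of sets `T` that upgrades to `closure (interior LOUD)` together with
a residual `LOUD ⊆ closure T(2E, ε/2)` over the unit stock proves the crux BY NAME (`S₀ := unitStock`).  A CONDITIONAL
statement: its second hypothesis, instantiated with `T := tameCrossing`, is the (crux-sized) residual of the line.
[folklore] -/
theorem RobustLoudUpgrade_of_residual (T : ∀ S : Finset (Fin 3 → ℤ), ℝ → ℝ → ℝ → Set (Coeff S))
    (hT : ∀ (S : Finset (Fin 3 → ℤ)) (a E ε : ℝ), T S a E ε ⊆ closure (interior (loud S a E ε)))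
    (hRes : ∀ S : Finset (Fin 3 → ℤ), unitStock ⊆ S → ∀ (a E ε : ℝ), 0 < a → 0 < ε →
      loud S a E ε ⊆ closure (T S a (2 * E) (ε / 2))) :
    RobustLoudUpgrade := by
  refine ⟨unitStock, fun S hS E ε hε j => ?_⟩
  have ha : (0 : ℝ) < 1 / ((j : ℝ) + 1) := by positivity
  intro c hc
  exact closure_minimal (hT S _ _ _) isClosed_closure (hRes S hS _ E ε ha hε hc)

/-- **Registered sub-goal `crossing_subset_robust`** (Pi-form of `crossingSteady_subset_robustCrossingSteady`). [folklore] -/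
theorem crossing_subset_robust : ∀ (S : Finset (Fin 3 → ℤ)) (a E ε : ℝ), crossingSteady S a E ε ⊆ robustCrossingSteady S a E ε :=
  crossingSteady_subset_robustCrossingSteady

end LsCrossing

end Summit.AnomalousDissipation.AnomalousDissipation.Theorems.RobustLoudUpgrade

end
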